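import Literature.AlgebraicGeometry.Resolution.TameQuotientSingularitiesResolutionProofs
import Literature.AlgebraicGeometry.Resolution.NormalCrossingsStrictification
import Literature.AlgebraicGeometry.Resolution.RegularHomReduced
import Literature.AlgebraicGeometry.Resolution.NormalAscent
import Mathlib.RingTheory.LocalProperties.Reduced
import Mathlib.AlgebraicGeometry.Morphisms.Etale
import Mathlib.RingTheory.RegularLocalRing.Defs
import HarnessLib

/-!
# Crux `FrobeniusLadder.FRationalResolution` (stmt-ResolutionOfSingularities-15317), line `redirect`,
# stub `stub_diagonalizableQuotientResolution` — the REGULAR-CHART normality package and the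
# dimension-`≤ 1` slice

The registered stub `stub_diagonalizableQuotientResolution` (skeleton `31452a5ba582e46f`) asks: an
integral separated finite-type `X/k` (ANY field `k`), every point of which lies in the image of an
étale `k`-morphism `Spec S₀ → X` from the degree-`0` part `S₀ = 𝒮 0` of a finitely generated
REGULAR `k`-algebra `S` graded by a finite abelian group `A` (`GradedAlgebra 𝒮`), has a resolution
of singularities. The Literature package `DiagonalizableQuotient.*`
(`TameQuotientSingularitiesResolutionProofs.lean`, written for the Bergh–Rydh print whose charts have
`Algebra.Smooth k S`) proves that such an `X` is NORMAL with singular locus in codimension `≥ 2`.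
Over an imperfect field the stub's charts are only `IsRegularRing S` (regular, not smooth), which is
exactly "the stub's own risk" (its docstring). This file re-runs the package on REGULAR charts — the
two uses of smoothness there (`S` reduced; localizations of `S` integrally closed) hold verbatim for
regular rings (Matsumura Thm. 14.3, 19.4, in the tree) — and draws the consequences for the stub:

* `isIntegrallyClosed_localization_of_isRegularRing` — all localizations of a regular ring are
  integrally closed (in their total rings of fractions; a regular ring is reduced,
  `IsRegularRing.isReduced'`, `RegularHomReduced.lean`);
* `isIntegrallyClosed_of_isLocalization_atPrime_gradeZero`, `isIntegrallyClosed_stalk_Spec_gradeZero`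
  — the local rings of the quotient chart `Spec S₀` are integrally closed (`S` regular, graded by a
  torsion group);
* `isIntegrallyClosed_stalk_of_regularChart` — `X` integral is normal along an étale chart
  `Spec S₀ → X` (normality descends along flat local maps, Stacks 033G);
* `isIntegrallyClosed_stalk_of_hq`, `regularLocus_of_hq` — under the stub's hypothesis VERBATIM:
  every local ring of `X` is an integrally closed domain, `Reg X` is open and dense, and every
  singular point has a local ring of dimension `≥ 2` (normal ⇒ (R₁));
* `hasResolution_of_isRegular`, `stub_diagonalizableQuotientResolution_of_ringKrullDim_stalk_le_one`,
  `stub_diagonalizableQuotientResolution_of_topologicalKrullDim_le_one` — **the stub in dimension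
  `≤ 1`** (with its binders verbatim plus the dimension bound): `X` is regular, the identity resolves.

Honest label: a SLICE (curves) and the first step (normality, singularities in codimension `≥ 2`) of
any proof of the stub; the stub itself (all dimensions: étale-local linearisation + functorial toric
desingularisation over arbitrary fields) stays open in the tree. No new definitions, no named facts,
no sorry. [folklore; cite: Matsumura1987, Thm. 11.2, Thm. 14.3, Thm. 19.4] [cite: StacksProject, Tag 033G]
[cite: BerghRydh2019, proof of Thm 5 (p. 4)]
-/

noncomputable section

-- single-problem summit: the doubled namespace component is forced
set_option linter.dupNamespace false

open CategoryTheory DirectSum AlgebraicGeometry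
open Literature.AlgebraicGeometry.Resolution
open Literature.AlgebraicGeometry.Resolution.DiagonalizableQuotient

namespace Summit.ResolutionOfSingularities.ResolutionOfSingularities.Theorems.FRationalResolution.DiagQuotientNormal

universe u v w

/-! ## Regular rings have integrally closed localizations -/

/-- **Every localization of a regular ring is integrally closed** in its total ring of fractions:
its local rings at maximal ideals are local rings of `S` at primes, regular, hence normal (Matsumura
Thm. 19.4), and integral closedness is checked at the maximal ideals
(`Literature.RingTheory.IntegralClosure.isIntegrallyClosed_of_localization_maximal`).
[cite: Matsumura1987, Thm. 19.4] -/
theorem isIntegrallyClosed_localization_of_isRegularRing (S : Type u) [CommRing S]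
    [IsRegularRing S] (N : Submonoid S) : IsIntegrallyClosed (Localization N) := by
  refine Literature.RingTheory.IntegralClosure.isIntegrallyClosed_of_localization_maximal
    fun p hp => ?_
  let P : Ideal S := p.comap (algebraMap S (Localization N))
  haveI : IsRegularLocalRing (Localization.AtPrime P) :=
    IsRegularRing.isRegularLocalRing_localization P
  haveI := isIntegrallyClosed_of_isRegularLocalRing (Localization.AtPrime P)
  exact IsIntegrallyClosed.of_equiv
    (IsLocalization.localizationLocalizationAtPrimeIsoLocalization N p).toRingEquiv

/-! ## The local rings of the quotient chart `Spec S₀`, for `S` regular -/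

section LocalRings

/-- **The local rings of the quotient chart `Spec S₀` are integrally closed** (in their total rings
of fractions), for `S` a REGULAR algebra over a field — possibly disconnected — graded by a torsion
group: `(S₀)_𝔮` is the degree-zero part of the graded, reduced, integrally closed ring `T⁻¹S`,
`T = S₀ ∖ 𝔮` (`DiagonalizableQuotient.isIntegrallyClosed_gradeZero_of_isReduced` and the graded
localization `Literature.RingTheory.GradedAlgebra.locPiece`). The smooth-chart version is
`DiagonalizableQuotient.isIntegrallyClosed_of_isLocalization_atPrime_gradeZero`. [folklore] -/
theorem isIntegrallyClosed_of_isLocalization_atPrime_gradeZero {k S : Type u} [Field k] [CommRing S]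
    [Algebra k S] [IsRegularRing S] {A : Type w} [DecidableEq A] [AddCommGroup A]
    (𝒮 : A → Submodule k S) [GradedAlgebra 𝒮] (hA : AddMonoid.IsTorsion A)
    (𝔮 : Ideal (𝒮 0)) [𝔮.IsPrime] (Rq : Type v) [CommRing Rq] [Algebra (𝒮 0) Rq]
    [IsLocalization.AtPrime Rq 𝔮] : IsIntegrallyClosed Rq := by
  classical
  -- the localization `L = T⁻¹S`, `T = image of S₀ ∖ 𝔮`, and its grading
  let T : Submonoid S := 𝔮.primeCompl.map (algebraMap (𝒮 0) S)
  have hT : ∀ t ∈ T, t ∈ 𝒮 0 := by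
    rintro _ ⟨r, -, rfl⟩
    exact r.2
  let L := Localization T
  let ℒ := Literature.RingTheory.GradedAlgebra.locPiece 𝒮 T hT L
  letI : GradedAlgebra ℒ :=
    (Literature.RingTheory.GradedAlgebra.nonempty_gradedAlgebra_locPiece 𝒮 T hT L).some
  -- `L` is reduced and integrally closed, so `ℒ 0` is integrally closed
  haveI : IsReduced S := IsRegularRing.isReduced' S
  haveI : IsIntegrallyClosed L := isIntegrallyClosed_localization_of_isRegularRing S T
  haveI : IsIntegrallyClosed (ℒ 0) := isIntegrallyClosed_gradeZero_of_isReduced ℒ hA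
  -- `ℒ 0` is the localization of `S₀` at `𝔮`
  letI := Literature.RingTheory.GradedAlgebra.locPieceZeroAlgebra 𝒮 T hT L
  have hloc := Literature.RingTheory.GradedAlgebra.isLocalization_locPiece_zero 𝒮 T hT L
  rw [Submonoid.comap_map_eq_of_injective (algebraMap_gradeZero_injective 𝒮)] at hloc
  haveI : IsLocalization.AtPrime (ℒ 0) 𝔮 := hloc
  exact IsIntegrallyClosed.of_equiv (R := ℒ 0)
    (IsLocalization.algEquiv 𝔮.primeCompl (ℒ 0) Rq).toRingEquiv

/-- In particular the localizations `(S₀)_𝔮` are integrally closed (`S` regular, torsion grading).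
[folklore] -/
theorem isIntegrallyClosed_localization_atPrime_gradeZero {k S : Type u} [Field k] [CommRing S]
    [Algebra k S] [IsRegularRing S] {A : Type w} [DecidableEq A] [AddCommGroup A]
    (𝒮 : A → Submodule k S) [GradedAlgebra 𝒮] (hA : AddMonoid.IsTorsion A)
    (𝔮 : Ideal (𝒮 0)) [𝔮.IsPrime] : IsIntegrallyClosed (Localization.AtPrime 𝔮) :=
  isIntegrallyClosed_of_isLocalization_atPrime_gradeZero 𝒮 hA 𝔮 _

/-- The stalks of the quotient chart `Spec S₀` are integrally closed (`S` regular, torsion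
grading). [folklore] -/
theorem isIntegrallyClosed_stalk_Spec_gradeZero {k S : Type u} [Field k] [CommRing S]
    [Algebra k S] [IsRegularRing S] {A : Type w} [DecidableEq A] [AddCommGroup A]
    (𝒮 : A → Submodule k S) [GradedAlgebra 𝒮] (hA : AddMonoid.IsTorsion A)
    (v : Spec (.of (𝒮 0))) : IsIntegrallyClosed ((Spec (.of (𝒮 0))).presheaf.stalk v) := by
  letI : Algebra (𝒮 0) ((Spec (.of (𝒮 0))).presheaf.stalk v) :=
    inferInstanceAs (Algebra (𝒮 0) ((Spec.structureSheaf (𝒮 0)).presheaf.stalk v))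
  haveI : IsLocalization.AtPrime ((Spec (.of (𝒮 0))).presheaf.stalk v) v.asIdeal :=
    StructureSheaf.IsLocalization.to_stalk (𝒮 0) v
  exact isIntegrallyClosed_of_isLocalization_atPrime_gradeZero 𝒮 hA v.asIdeal _

end LocalRings

/-! ## `X` is normal along regular charts -/

/-- **`X` is normal along every REGULAR chart of the stub**: for an étale chart `φ : Spec S₀ ⟶ X`
with `S` a regular algebra over the field `k` (possibly disconnected) graded by the FINITE abelian
group `A`, and `X` integral, the local ring of `X` at every `φ v` is an integrally closed domain
(the stalk of `Spec S₀` at `v` is integrally closed, and normality descends along the flat local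
stalk map of the étale `φ`, Stacks 033G). [cite: StacksProject, Tag 033G] -/
theorem isIntegrallyClosed_stalk_of_regularChart {k : Type u} [Field k] {A : Type w}
    [DecidableEq A] [AddCommGroup A] [Finite A] {S : Type u} [CommRing S] [Algebra k S]
    [IsRegularRing S] (𝒮 : A → Submodule k S) [GradedAlgebra 𝒮] {X : Scheme.{u}} [IsIntegral X]
    (φ : Spec (.of (𝒮 0)) ⟶ X) [Etale φ] (v : Spec (.of (𝒮 0))) :
    IsIntegrallyClosed (X.presheaf.stalk (φ.base v)) := by
  haveI := isIntegrallyClosed_stalk_Spec_gradeZero 𝒮 (fun a => isOfFinAddOrder_of_finite a) v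
  exact isIntegrallyClosed_stalk_of_flat' φ v

/-! ## Under the stub's hypothesis (verbatim): `X` is normal, `Sing X` has codimension `≥ 2` -/

/-- **Under the hypothesis `hq` of `stub_diagonalizableQuotientResolution` (verbatim), `X` is
normal**: every local ring of the integral scheme `X` is an integrally closed domain.
[cite: BerghRydh2019, proof of Thm 5 (p. 4)] -/
theorem isIntegrallyClosed_stalk_of_hq (k : Type) [Field k] (X : Scheme.{0})
    (g : X ⟶ Spec (.of k)) [IsIntegral X]
    (hq : ∀ x : X, ∃ (A : Type) (_ : AddCommGroup A) (_ : Finite A) (_ : DecidableEq A)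
        (S : Type) (_ : CommRing S) (_ : Algebra k S) (𝒮 : A → Submodule k S)
        (_ : GradedAlgebra 𝒮), Algebra.FiniteType k S ∧ IsRegularRing S ∧
        ∃ φ : Spec (.of (𝒮 0)) ⟶ X, Etale φ ∧ x ∈ Set.range φ ∧
          φ ≫ g = Spec.map (CommRingCat.ofHom (algebraMap k (𝒮 0))))
    (x : X) : IsIntegrallyClosed (X.presheaf.stalk x) := by
  obtain ⟨A, _, _, _, S, _, _, 𝒮, _, -, _, φ, _, ⟨v, rfl⟩, -⟩ := hq x
  exact isIntegrallyClosed_stalk_of_regularChart 𝒮 φ v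

/-- **What any proof of the stub uses first** (Satriano / Bergh–Rydh input, regular-chart form):
under `hq` verbatim, the regular locus `Reg X` is OPEN (finite type over a field), DENSE (`X`
reduced), and every singular point has a local ring of dimension `> 1` — the local rings are
normal (`isIntegrallyClosed_stalk_of_hq`) and normal ⇒ (R₁) (Matsumura Thm. 11.2). In words: `X`
is a normal variety whose singular locus is closed of codimension `≥ 2`.
[cite: Matsumura1987, Thm. 11.2] [cite: BerghRydh2019, proof of Thm 5 (p. 4)] -/
theorem regularLocus_of_hq (k : Type) [Field k] (X : Scheme.{0})
    (g : X ⟶ Spec (.of k)) [IsIntegral X] [LocallyOfFiniteType g]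
    (hq : ∀ x : X, ∃ (A : Type) (_ : AddCommGroup A) (_ : Finite A) (_ : DecidableEq A)
        (S : Type) (_ : CommRing S) (_ : Algebra k S) (𝒮 : A → Submodule k S)
        (_ : GradedAlgebra 𝒮), Algebra.FiniteType k S ∧ IsRegularRing S ∧
        ∃ φ : Spec (.of (𝒮 0)) ⟶ X, Etale φ ∧ x ∈ Set.range φ ∧
          φ ≫ g = Spec.map (CommRingCat.ofHom (algebraMap k (𝒮 0)))) :
    IsOpen (Scheme.regularLocus X) ∧ Dense (Scheme.regularLocus X) ∧
      ∀ x : X, x ∉ Scheme.regularLocus X → 1 < ringKrullDim (X.presheaf.stalk x) := by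
  haveI : IsLocallyNoetherian X := LocallyOfFiniteType.isLocallyNoetherian g
  refine ⟨isOpen_regularLocus_of_locallyOfFiniteType_field g, Scheme.dense_regularLocus X,
    fun x hx => ?_⟩
  by_contra hle
  rw [not_lt] at hle
  haveI := isIntegrallyClosed_stalk_of_hq k X g hq x
  exact hx (isRegularLocalRing_of_isIntegrallyClosed_of_dim_le_one _ hle)

/-- Under `hq` verbatim, a point whose local ring has dimension `≤ 1` is a regular point of `X`.
[cite: Matsumura1987, Thm. 11.2] -/
theorem mem_regularLocus_of_hq_of_ringKrullDim_le_one (k : Type) [Field k] (X : Scheme.{0})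
    (g : X ⟶ Spec (.of k)) [IsIntegral X] [LocallyOfFiniteType g]
    (hq : ∀ x : X, ∃ (A : Type) (_ : AddCommGroup A) (_ : Finite A) (_ : DecidableEq A)
        (S : Type) (_ : CommRing S) (_ : Algebra k S) (𝒮 : A → Submodule k S)
        (_ : GradedAlgebra 𝒮), Algebra.FiniteType k S ∧ IsRegularRing S ∧
        ∃ φ : Spec (.of (𝒮 0)) ⟶ X, Etale φ ∧ x ∈ Set.range φ ∧
          φ ≫ g = Spec.map (CommRingCat.ofHom (algebraMap k (𝒮 0))))
    {x : X} (hx : ringKrullDim (X.presheaf.stalk x) ≤ 1) : x ∈ Scheme.regularLocus X := by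
  by_contra h
  exact not_lt.mpr hx ((regularLocus_of_hq k X g hq).2.2 x h)

/-! ## The stub in dimension `≤ 1` -/

/-- A regular scheme has a resolution of singularities: the identity (proper; birational over the
dense open `⊤`). [folklore] -/
theorem hasResolution_of_isRegular (X : Scheme.{u}) (h : Scheme.IsRegular X) :
    Scheme.HasResolution X :=
  ⟨X, 𝟙 X, ⟨inferInstance, ⟨⊤, by simp [dense_univ], by simp [dense_univ], inferInstance⟩, h⟩⟩

/-- **Under `hq` verbatim, if every local ring of `X` has dimension `≤ 1` then `X` is regular**
(normal ⇒ (R₁) at every point). [cite: Matsumura1987, Thm. 11.2] -/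
theorem isRegular_of_hq_of_ringKrullDim_stalk_le_one (k : Type) [Field k] (X : Scheme.{0})
    (g : X ⟶ Spec (.of k)) [IsIntegral X] [LocallyOfFiniteType g]
    (hq : ∀ x : X, ∃ (A : Type) (_ : AddCommGroup A) (_ : Finite A) (_ : DecidableEq A)
        (S : Type) (_ : CommRing S) (_ : Algebra k S) (𝒮 : A → Submodule k S)
        (_ : GradedAlgebra 𝒮), Algebra.FiniteType k S ∧ IsRegularRing S ∧
        ∃ φ : Spec (.of (𝒮 0)) ⟶ X, Etale φ ∧ x ∈ Set.range φ ∧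
          φ ≫ g = Spec.map (CommRingCat.ofHom (algebraMap k (𝒮 0))))
    (hdim : ∀ x : X, ringKrullDim (X.presheaf.stalk x) ≤ 1) : Scheme.IsRegular X :=
  fun x => (Scheme.mem_regularLocus x).mp
    (mem_regularLocus_of_hq_of_ringKrullDim_le_one k X g hq (hdim x))

/-- **`stub_diagonalizableQuotientResolution` IN DIMENSION `≤ 1`, pointwise form** (the stub's
binders verbatim, plus `dim 𝒪_{X,x} ≤ 1` at every point): `X` is regular
(`isRegular_of_hq_of_ringKrullDim_stalk_le_one`), so the identity is a resolution. The separatedness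
and quasi-compactness binders of the stub are carried only to match its shape.
[cite: Matsumura1987, Thm. 11.2] -/
theorem stub_diagonalizableQuotientResolution_of_ringKrullDim_stalk_le_one (k : Type) [Field k]
    (X : Scheme.{0}) (g : X ⟶ Spec (.of k)) [IsIntegral X] [IsSeparated g]
    [LocallyOfFiniteType g] [QuasiCompact g]
    (hq : ∀ x : X, ∃ (A : Type) (_ : AddCommGroup A) (_ : Finite A) (_ : DecidableEq A)
        (S : Type) (_ : CommRing S) (_ : Algebra k S) (𝒮 : A → Submodule k S)
        (_ : GradedAlgebra 𝒮), Algebra.FiniteType k S ∧ IsRegularRing S ∧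
        ∃ φ : Spec (.of (𝒮 0)) ⟶ X, Etale φ ∧ x ∈ Set.range φ ∧
          φ ≫ g = Spec.map (CommRingCat.ofHom (algebraMap k (𝒮 0))))
    (hdim : ∀ x : X, ringKrullDim (X.presheaf.stalk x) ≤ 1) : Scheme.HasResolution X :=
  hasResolution_of_isRegular X (isRegular_of_hq_of_ringKrullDim_stalk_le_one k X g hq hdim)

/-- **`stub_diagonalizableQuotientResolution` IN DIMENSION `≤ 1`** (the stub's binders verbatim,
plus `dim X ≤ 1`): CURVES with diagonalizable quotient singularities presented by regular charts are
regular, over every field (`dim 𝒪_{X,x} ≤ dim X`, `ringKrullDim_stalk_le_topologicalKrullDim`).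
[cite: Matsumura1987, Thm. 11.2] -/
theorem stub_diagonalizableQuotientResolution_of_topologicalKrullDim_le_one (k : Type) [Field k]
    (X : Scheme.{0}) (g : X ⟶ Spec (.of k)) [IsIntegral X] [IsSeparated g]
    [LocallyOfFiniteType g] [QuasiCompact g]
    (hq : ∀ x : X, ∃ (A : Type) (_ : AddCommGroup A) (_ : Finite A) (_ : DecidableEq A)
        (S : Type) (_ : CommRing S) (_ : Algebra k S) (𝒮 : A → Submodule k S)
        (_ : GradedAlgebra 𝒮), Algebra.FiniteType k S ∧ IsRegularRing S ∧
        ∃ φ : Spec (.of (𝒮 0)) ⟶ X, Etale φ ∧ x ∈ Set.range φ ∧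
          φ ≫ g = Spec.map (CommRingCat.ofHom (algebraMap k (𝒮 0))))
    (hdim : topologicalKrullDim X ≤ 1) : Scheme.HasResolution X :=
  stub_diagonalizableQuotientResolution_of_ringKrullDim_stalk_le_one k X g hq
    fun x => (ringKrullDim_stalk_le_topologicalKrullDim X x).trans hdim

/-! ## The local rings of the quotient chart are normal DOMAINS (regular `S` of finite type) -/

/-- **The local rings `(S₀)_𝔮` of the quotient chart are (normal) DOMAINS**, for `S` a regular algebra
of finite type over a field — possibly DISCONNECTED — graded by a torsion group: `(S₀)_𝔮` is reduced
(a localization of a subring of the reduced `S`), Noetherian (`S₀` is of finite type, Artin–Tate),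
local and integrally closed in its total ring of fractions
(`isIntegrallyClosed_localization_atPrime_gradeZero`), hence a domain
(`isDomain_of_isReduced_of_isIntegrallyClosed`, Stacks 031S). First half of dropping the DOMAIN
hypothesis on the charts in `…GradeZeroWeaklyFRegular.lean`. [cite: StacksProject, Tag 031S] -/
theorem isDomain_localization_atPrime_gradeZero {k S : Type u} [Field k] [CommRing S]
    [Algebra k S] [IsRegularRing S] [Algebra.FiniteType k S] {A : Type w} [DecidableEq A]
    [AddCommGroup A] (𝒮 : A → Submodule k S) [GradedAlgebra 𝒮] (hA : AddMonoid.IsTorsion A)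
    (𝔮 : Ideal (𝒮 0)) [𝔮.IsPrime] : IsDomain (Localization.AtPrime 𝔮) := by
  haveI : IsReduced S := IsRegularRing.isReduced' S
  haveI : IsReduced (𝒮 0) := isReduced_of_injective (algebraMap (𝒮 0) S)
    (algebraMap_gradeZero_injective 𝒮)
  haveI : IsReduced (Localization.AtPrime 𝔮) :=
    isReduced_localizationPreserves 𝔮.primeCompl (Localization.AtPrime 𝔮) inferInstance
  haveI : IsNoetherianRing (𝒮 0) := isNoetherianRing_gradeZero 𝒮 hA
  haveI : IsNoetherianRing (Localization.AtPrime 𝔮) :=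
    IsLocalization.isNoetherianRing 𝔮.primeCompl _ inferInstance
  haveI : IsIntegrallyClosed (Localization.AtPrime 𝔮) :=
    isIntegrallyClosed_localization_atPrime_gradeZero 𝒮 hA 𝔮
  exact isDomain_of_isReduced_of_isIntegrallyClosed (B := Localization.AtPrime 𝔮)

/-- **The stalks of the quotient chart `Spec S₀` are domains** (same hypotheses). [cite: StacksProject, Tag 031S] -/
theorem isDomain_stalk_Spec_gradeZero {k S : Type u} [Field k] [CommRing S]
    [Algebra k S] [IsRegularRing S] [Algebra.FiniteType k S] {A : Type w} [DecidableEq A]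
    [AddCommGroup A] (𝒮 : A → Submodule k S) [GradedAlgebra 𝒮] (hA : AddMonoid.IsTorsion A)
    (v : Spec (.of (𝒮 0))) : IsDomain ((Spec (.of (𝒮 0))).presheaf.stalk v) := by
  letI : Algebra (𝒮 0) ((Spec (.of (𝒮 0))).presheaf.stalk v) :=
    inferInstanceAs (Algebra (𝒮 0) ((Spec.structureSheaf (𝒮 0)).presheaf.stalk v))
  haveI : IsLocalization.AtPrime ((Spec (.of (𝒮 0))).presheaf.stalk v) v.asIdeal :=
    StructureSheaf.IsLocalization.to_stalk (𝒮 0) v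
  haveI := isDomain_localization_atPrime_gradeZero 𝒮 hA v.asIdeal
  exact (IsLocalization.algEquiv v.asIdeal.primeCompl ((Spec (.of (𝒮 0))).presheaf.stalk v)
    (Localization.AtPrime v.asIdeal)).toMulEquiv.isDomain

end Summit.ResolutionOfSingularities.ResolutionOfSingularities.Theorems.FRationalResolution.DiagQuotientNormal

end
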